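import Summits.PneNP.PneNP.Theses.CodingVolumeShifts

/-!
# Route CodingVolumeShifts — support item `VolumeToShifts` (stmt-PneNP-19456)

`VolumeToShifts := CodingVolume → ∀ Δ K, ∃ n₀, ∀ n ≥ n₀, ∀ W : KPairsNet (Fin n), W.DegLE Δ →
W.arcCount ≤ K * n → ¬ W.RealizesAllShifts`: the coding-volume statement X ("for every degree bound
`Δ` and constant `C` there is a distance `L` such that every `Δ`-bounded k-pairs DAG whose pairs are
all `L`-far and which carries a binary one-shot code has `≥ C·k` arcs") implies that no linear-size
bounded-degree wiring with re-programmable gates realises all `n` cyclic shifts (T).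

Proof (the averaging step of [AfshaniEtAl2019, §4, proof of Thm 2: "there exists a shift `ℓ₀` such
that `|{j : d(x_j, y_{j+ℓ₀-1}) ≥ ½ log_c n}| ≥ n − 2√n`"], here with a constant distance scale):
take `C := K + 1`, its `L`, and `B := (2Δ+1)^L`.
1. `exists_walk_ball` / `exists_ball_cover`: in the undirected graph of a network with in- and
   out-degrees `≤ Δ` the vertices at extended distance `< L` from a fixed vertex lie in a finset of
   size `≤ B` (walk induction; a neighbour is the head of an out-arc or the tail of an in-arc).
2. `exists_shift_few_near`: double counting `Σ_s #{i : d(in_i, out_{i+s}) < L} = Σ_i #{s : …} ≤ n·B`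
   (for fixed `i`, `s ↦ out_{i+s}` is injective into the ball of `in_i`), so some shift `s` has at
   most `B` near pairs.
3. Restricting the shift-`s` code to the far pairs (`KPairsNet.Code.restrict`) gives an `L`-far
   sub-instance with the same `≤ K·n` arcs and `≥ n − B` commodities; X gives `(K+1)(n − B) ≤ K·n`,
   impossible for `n ≥ (K+1)·B + 1 =: n₀`.

No new definitions; imports only the route file.

Appended (stmt-PneNP-19895): `codingVolumeShifts_assembly_proof` — the route's crux-level chain
`Assembly := CodingVolume → ShiftVolumeLift → PneNP` by modus ponens through the theorem above
(kept in this module so that no further file enters the route's rebuild cone).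
-/

set_option linter.dupNamespace false -- `Summit.PneNP.PneNP.…`: summit = sub-problem name (D-0017)

namespace Summit.PneNP.PneNP.Theorems

open Literature.InformationTheory.NetworkCoding Finset

section Ball

variable {ι : Type} (N : KPairsNet ι)

/-- One undirected step in the underlying graph of a k-pairs network: a neighbour `w` of `u` is the
head of an arc leaving `u` or the tail of an arc entering `u`. [folklore] -/
theorem codingVolumeShifts_mem_image_of_adj {u w : N.V} (h : N.graph.Adj w u) :
    w ∈ (N.outArcs u).image N.tgt ∪ (N.inArcs u).image N.src := by
  rw [KPairsNet.graph, SimpleGraph.fromRel_adj] at h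
  obtain ⟨-, ⟨a, ha, hb⟩ | ⟨a, ha, hb⟩⟩ := h
  · refine Finset.mem_union_right _ (Finset.mem_image.mpr ⟨a, ?_, ha⟩)
    simp [KPairsNet.inArcs, hb]
  · refine Finset.mem_union_left _ (Finset.mem_image.mpr ⟨a, ?_, hb⟩)
    simp [KPairsNet.outArcs, ha]

/-- Ball growth under a degree bound: in a k-pairs network with in- and out-degrees `≤ Δ`, the
vertices joined to `v` by an undirected walk of length `≤ d` lie in a finset of size `≤ (2Δ+1)^d`.
[folklore] -/
theorem codingVolumeShifts_exists_walk_ball {Δ : ℕ} (hΔ : N.DegLE Δ) (v : N.V) (d : ℕ) :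
    ∃ S : Finset N.V, S.card ≤ (2 * Δ + 1) ^ d ∧
      ∀ w (q : N.graph.Walk w v), q.length ≤ d → w ∈ S := by
  induction d with
  | zero =>
    refine ⟨{v}, by simp, fun w q hq => ?_⟩
    rw [Finset.mem_singleton]
    exact q.eq_of_length_eq_zero (Nat.le_zero.mp hq)
  | succ d ih =>
    obtain ⟨S, hS, hmem⟩ := ih
    refine ⟨S ∪ S.biUnion (fun u => (N.outArcs u).image N.tgt ∪ (N.inArcs u).image N.src), ?_, ?_⟩
    · calc (S ∪ S.biUnion (fun u => (N.outArcs u).image N.tgt ∪ (N.inArcs u).image N.src)).card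
          ≤ S.card + (S.biUnion (fun u => (N.outArcs u).image N.tgt ∪ (N.inArcs u).image N.src)).card :=
            Finset.card_union_le _ _
        _ ≤ S.card + ∑ u ∈ S, ((N.outArcs u).image N.tgt ∪ (N.inArcs u).image N.src).card := by
            gcongr
            exact Finset.card_biUnion_le
        _ ≤ S.card + ∑ u ∈ S, 2 * Δ := by
            gcongr with u hu
            calc ((N.outArcs u).image N.tgt ∪ (N.inArcs u).image N.src).card
                ≤ ((N.outArcs u).image N.tgt).card + ((N.inArcs u).image N.src).card :=
                  Finset.card_union_le _ _
              _ ≤ (N.outArcs u).card + (N.inArcs u).card := by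
                  gcongr <;> exact Finset.card_image_le
              _ ≤ Δ + Δ := by
                  gcongr
                  exacts [(hΔ u).2, (hΔ u).1]
              _ = 2 * Δ := by ring
        _ = S.card * (2 * Δ + 1) := by rw [Finset.sum_const, smul_eq_mul]; ring
        _ ≤ (2 * Δ + 1) ^ d * (2 * Δ + 1) := by gcongr
        _ = (2 * Δ + 1) ^ (d + 1) := by ring
    · intro w q hq
      cases q with
      | nil => exact Finset.mem_union_left _ (hmem _ .nil (by simp))
      | cons h q' =>
        have hq' : q'.length ≤ d := by
          rw [SimpleGraph.Walk.length_cons] at hq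
          omega
        exact Finset.mem_union_right _
          (Finset.mem_biUnion.mpr ⟨_, hmem _ q' hq', codingVolumeShifts_mem_image_of_adj N h⟩)

/-- The ball bound at the distance scale of `Far`: in a k-pairs network with in- and out-degrees
`≤ Δ`, the vertices at undirected extended distance `< L` from `v` lie in a finset of size
`≤ (2Δ+1)^L`. [folklore] -/
theorem codingVolumeShifts_exists_ball_cover {Δ : ℕ} (hΔ : N.DegLE Δ) (v : N.V) (L : ℕ) :
    ∃ S : Finset N.V, S.card ≤ (2 * Δ + 1) ^ L ∧ ∀ w, N.graph.edist v w < L → w ∈ S := by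
  obtain ⟨S, hS, hmem⟩ := codingVolumeShifts_exists_walk_ball N hΔ v L
  refine ⟨S, hS, fun w hw => ?_⟩
  obtain ⟨p, hp⟩ := SimpleGraph.exists_walk_of_edist_ne_top (ne_top_of_lt hw)
  refine hmem w p.reverse ?_
  rw [SimpleGraph.Walk.length_reverse]
  have hlt : (p.length : ℕ∞) < L := by rw [hp]; exact hw
  exact (by exact_mod_cast hlt : p.length < L).le

end Ball

section Shifts

variable {n : ℕ} (W : KPairsNet (Fin n))

/-- Powers of the rotation act by addition: `(finRotate n)^s i = i + s` (cf.
`finCycle_eq_finRotate_iterate`). [folklore] -/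
theorem codingVolumeShifts_finRotate_pow_apply (s i : Fin n) :
    ((finRotate n) ^ (s : ℕ)) i = i + s := by
  rw [Equiv.Perm.coe_pow, ← finCycle_eq_finRotate_iterate, finCycle_apply]

/-- For a fixed input `i` of a wiring on `Fin n`, the shifts `s` whose output `i + s` is within
undirected distance `< L` of input `i` are no more than the vertices near input `i` (the map
`s ↦ out_{i+s}` is injective). [folklore] -/
theorem codingVolumeShifts_card_near_shifts_le {B L : ℕ} (i : Fin n)
    (hS : ∃ S : Finset W.V, S.card ≤ B ∧ ∀ w, W.graph.edist (W.source i) w < L → w ∈ S) :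
    (univ.filter fun s : Fin n =>
      W.graph.edist (W.source i) (W.sink (((finRotate n) ^ (s : ℕ)) i)) < L).card ≤ B := by
  obtain ⟨S, hS, hmem⟩ := hS
  refine le_trans (Finset.card_le_card_of_injOn
    (fun s : Fin n => W.sink (((finRotate n) ^ (s : ℕ)) i)) ?_ ?_) hS
  · intro s hs
    rw [Finset.mem_coe, Finset.mem_filter] at hs
    exact Finset.mem_coe.mpr (hmem _ hs.2)
  · intro s _ t _ hst
    have h := W.sink.injective hst
    rw [codingVolumeShifts_finRotate_pow_apply, codingVolumeShifts_finRotate_pow_apply] at h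
    exact add_left_cancel h

/-- Averaging over the `n` cyclic shifts ([AfshaniEtAl2019] §4): if every input of a wiring on
`Fin n` (`n ≥ 1`) has at most `B` vertices within undirected distance `< L`, then for some shift
`s` at most `B` inputs `i` are within distance `< L` of their output `i + s` — because
`Σ_s #{i near out_{i+s}} = Σ_i #{s : out_{i+s} near in_i} ≤ n·B`. [folklore] -/
theorem codingVolumeShifts_exists_shift_few_near {B L : ℕ} (hn : 0 < n)
    (hS : ∀ v : W.V, ∃ S : Finset W.V, S.card ≤ B ∧ ∀ w, W.graph.edist v w < L → w ∈ S) :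
    ∃ s : Fin n, (univ.filter fun i : Fin n =>
      W.graph.edist (W.source i) (W.sink (((finRotate n) ^ (s : ℕ)) i)) < L).card ≤ B := by
  by_contra h
  push Not at h
  have hsum : ∑ s : Fin n, (univ.filter fun i : Fin n =>
      W.graph.edist (W.source i) (W.sink (((finRotate n) ^ (s : ℕ)) i)) < L).card ≤ n * B :=
    calc ∑ s : Fin n, (univ.filter fun i : Fin n =>
            W.graph.edist (W.source i) (W.sink (((finRotate n) ^ (s : ℕ)) i)) < L).card
        = ∑ s : Fin n, ∑ i : Fin n,
            (if W.graph.edist (W.source i) (W.sink (((finRotate n) ^ (s : ℕ)) i)) < L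
              then 1 else 0) := by
          simp_rw [Finset.card_filter]
      _ = ∑ i : Fin n, ∑ s : Fin n,
            (if W.graph.edist (W.source i) (W.sink (((finRotate n) ^ (s : ℕ)) i)) < L
              then 1 else 0) := Finset.sum_comm
      _ = ∑ i : Fin n, (univ.filter fun s : Fin n =>
            W.graph.edist (W.source i) (W.sink (((finRotate n) ^ (s : ℕ)) i)) < L).card := by
          simp_rw [Finset.card_filter]
      _ ≤ ∑ _i : Fin n, B :=
          Finset.sum_le_sum fun i _ =>
            codingVolumeShifts_card_near_shifts_le W i (hS (W.source i))
      _ = n * B := by simp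
  have hlow : n * (B + 1) ≤ ∑ s : Fin n, (univ.filter fun i : Fin n =>
      W.graph.edist (W.source i) (W.sink (((finRotate n) ^ (s : ℕ)) i)) < L).card :=
    calc n * (B + 1) = ∑ _s : Fin n, (B + 1) := by simp
      _ ≤ _ := Finset.sum_le_sum fun s _ => Nat.succ_le_of_lt (h s)
  have hle : n * (B + 1) ≤ n * B := hlow.trans hsum
  have : B + 1 ≤ B := Nat.le_of_mul_le_mul_left hle hn
  omega

end Shifts

/-- **Support item `VolumeToShifts` of route CodingVolumeShifts (stmt-PneNP-19456; S1, X → T).**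
If for every degree bound `Δ` and constant `C` there is a distance `L` such that every
`Δ`-bounded k-pairs DAG with all pairs `L`-far carrying a binary one-shot code has `≥ C·k` arcs
(`CodingVolume`), then for every `Δ, K` there is `n₀` such that no wiring on `n ≥ n₀` inputs with
in/out-degrees `≤ Δ` and `≤ K·n` arcs realises all `n` cyclic shifts with re-programmable gates.
Proof: `C := K+1`, ball bound `B := (2Δ+1)^L`, averaging over the shifts gives a shift with `≤ B`
near pairs, and the restriction of its code to the `≥ n − B` far pairs (`Code.restrict`) contradicts
`CodingVolume` once `n ≥ (K+1)·B + 1` (the averaging step of [AfshaniEtAl2019] §4, made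
unconditional in its hypothesis X instead of the multiple-unicast conjecture). [folklore] -/
theorem codingVolumeShifts_volumeToShifts_proof :
    Summit.PneNP.PneNP.Theses.CodingVolumeShifts.VolumeToShifts := by
  unfold Summit.PneNP.PneNP.Theses.CodingVolumeShifts.VolumeToShifts
    Summit.PneNP.PneNP.Theses.CodingVolumeShifts.CodingVolume
  intro hX Δ K
  obtain ⟨L, hL⟩ := hX Δ (K + 1)
  refine ⟨(K + 1) * (2 * Δ + 1) ^ L + 1, ?_⟩
  intro n hn W hΔ harc hreal
  set B : ℕ := (2 * Δ + 1) ^ L with hB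
  have hn0 : 0 < n := by omega
  -- a shift with at most `B` near pairs
  obtain ⟨s, hs⟩ := codingVolumeShifts_exists_shift_few_near W hn0
    (fun v => codingVolumeShifts_exists_ball_cover W hΔ v L)
  -- the near commodities `D` of shift `s` and the far ones `G`
  set D : Finset (Fin n) := univ.filter fun i : Fin n =>
      W.graph.edist (W.source i) (W.sink (((finRotate n) ^ (s : ℕ)) i)) < L with hD
  set G : Finset (Fin n) := Dᶜ with hG
  let e : {i // i ∈ G} ↪ Fin n := Function.Embedding.subtype _
  obtain ⟨c⟩ := hreal s
  -- the shift-`s` instance restricted to its far commodities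
  let N' : KPairsNet {i // i ∈ G} := (W.shiftNet s).rewire e e
  have hcode : Nonempty N'.Code := ⟨c.restrict e⟩
  have hdeg : N'.DegLE Δ :=
    (W.shiftNet s).rewire_degLE e e (W.rewire_degLE _ _ hΔ)
  have hfar : N'.Far L := by
    intro j
    have hj : j.1 ∉ D := Finset.mem_compl.mp j.2
    rw [hD, Finset.mem_filter] at hj
    show (L : ℕ∞) ≤ W.graph.edist (W.source j.1) (W.sink (((finRotate n) ^ (s : ℕ)) j.1))
    exact not_lt.mp fun hlt => hj ⟨Finset.mem_univ _, hlt⟩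
  have key := hL {i // i ∈ G} N' hdeg hfar hcode
  have hcardG : Fintype.card {i // i ∈ G} = n - D.card := by
    rw [Fintype.card_coe, hG, Finset.card_compl, Fintype.card_fin]
  have harc' : N'.arcCount = W.arcCount := rfl
  rw [hcardG, harc'] at key
  -- arithmetic: (K+1)(n - B) ≤ (K+1)(n - #D) ≤ m ≤ K n with n ≥ (K+1) B + 1
  have h1 : (K + 1) * (n - B) ≤ K * n :=
    calc (K + 1) * (n - B) ≤ (K + 1) * (n - D.card) :=
          Nat.mul_le_mul_left _ (Nat.sub_le_sub_left hs n)
      _ ≤ W.arcCount := key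
      _ ≤ K * n := harc
  have hBn : B ≤ n := le_trans (le_trans (Nat.le_mul_of_pos_left B (Nat.succ_pos K))
    (Nat.le_succ _)) hn
  obtain ⟨t, ht⟩ := Nat.exists_eq_add_of_le hBn
  have hnt : n - B = t := by rw [ht, Nat.add_sub_cancel_left]
  rw [hnt] at h1
  rw [ht] at h1 hn
  have e1 : (K + 1) * t = K * t + t := by ring
  have e2 : K * (B + t) = K * B + K * t := by ring
  have e3 : (K + 1) * B = K * B + B := by ring
  rw [e1, e2] at h1
  rw [e3] at hn
  omega

/-- **Assembly of route CodingVolumeShifts (stmt-PneNP-19895):** `CodingVolume → ShiftVolumeLift →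
PneNP` — X gives T by the proved support S1 (`codingVolumeShifts_volumeToShifts_proof`), and the
declared residual R = `ShiftVolumeLift` (T → P ≠ NP, open and never attacked here) carries T to the
summit: `fun hX hR => hR (s1 hX)`. Closes the assembly item only; the cruxes X and R stay open and
nothing here bears on P vs NP itself. [folklore] -/
theorem codingVolumeShifts_assembly_proof :
    Summit.PneNP.PneNP.Theses.CodingVolumeShifts.Assembly :=
  fun hX hR => hR (codingVolumeShifts_volumeToShifts_proof hX)

end Summit.PneNP.PneNP.Theorems
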